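import Summits.KontsevichZagierPeriods.KontsevichZagierPeriods.Theorems.SectorTwoSix.Negative.LoadBearing

/-!
# `SectorTwoSix` (stmt-KontsevichZagierPeriods-3870) — negative side II: the CDT hypothesis is
# NECESSARY for the rigidity half (value-rigidity of the level-6 normal forms ⇒ CDT's Theorem 1)

Companion of `Negative/LoadBearing.lean` (cdisprove unit of the crux `SectorTwoSix`, route
`HurwitzMicroSectors`). The route proves the crux as REDUCTION (every sector representation is
KZ-equivalent to a normal form `[box, a + b/(1−xy) + c/(1+xy+x²y²)]`, item `ReductionTwoSix`) +
RIGIDITY (under CDT, equal values of normal forms force equal coefficients, item `RigidityTwoSix`).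
`LoadBearing.lean` §1 shows CDT is NOT load-bearing for the TRUTH of the crux (its conclusion is a
sub-case of Conjecture 1). This file shows it IS load-bearing for the route's PROOF, sharply:

* `value_nfRep` — the normal form `[box, a + b/(1−xy) + c/(1+xy+x²y²)]` (a genuine
  `KZ.IntegralRep 2`: rational integrand `p/(1 − (xy)³)`, integrable by the tree's
  `BoxIntegral.integrableOn_box_normalForm`) has value `a + b·π²/6 + c·L(2,χ₋₃)`
  (`BoxIntegral.setIntegral_box_normalForm`);
* `cdt_of_rigidityTwoSixConclusion` — **the conclusion of `RigidityTwoSix` (its CDT antecedent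
  deleted, everything else verbatim) IMPLIES CDT's Theorem 1**: a rational relation
  `g₀ + g₁π² + g₂L(2,χ₋₃) = 0` makes the normal forms `(g₀, 6g₁, g₂)` and `(0,0,0)` equal-valued,
  so rigidity forces `g = 0`. Hence the rigidity half is EXACTLY as strong as CDT (the converse,
  CDT ⇒ rigidity, is the tree's `BoxIntegral.normalForm_coeff_eq`, i.e. item `RigidityTwoSix`, a
  prover's landing): the hypothesis of the crux cannot be weakened to, e.g., the irrationality of
  `L(2,χ₋₃)` or of `π²` alone along this route, and an unconditional proof of the level-6 rigidity
  would be an unconditional Lean proof of Calegari–Dimitrov–Tang.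

Sources: F. Calegari, V. Dimitrov, Y. Tang, *The linear independence of 1, ζ(2) and L(2,χ₋₃)*
(2024), Thm. 1; M. Kontsevich, D. Zagier, *Periods* (2001), §1.2.
-/

noncomputable section

open MeasureTheory Set
open Literature.NumberTheory.Transcendental Literature.ModelTheory.ExponentialFields

namespace Summit.KontsevichZagierPeriods.Theorems.SectorTwoSix.Negative

/-! ## §5 The normal-form representation and its value -/

/-- The route's normal-form integrand `a + b/(1−xy) + c/(1+xy+x²y²)`, literally as inlined in
`RigidityTwoSix` / `ReductionTwoSix`. [folklore] -/
def nfFun (a b c : ℚ) (x : Fin 2 → ℝ) : ℝ :=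
  (a : ℝ) + b / (1 - x 0 * x 1) + c / (1 + x 0 * x 1 + (x 0 * x 1) ^ 2)

/-- Its numerator over the common denominator `1 − (X₀X₁)³ = (1 − X₀X₁)(1 + X₀X₁ + (X₀X₁)²)`:
`a(1 − t³) + b(1 + t + t²) + c(1 − t)`, `t = X₀X₁`. [folklore] -/
def nfNum (a b c : ℚ) : MvPolynomial (Fin 2) ℚ :=
  MvPolynomial.C a * (1 - (MvPolynomial.X 0 * MvPolynomial.X 1) ^ 3) +
    MvPolynomial.C b * (1 + MvPolynomial.X 0 * MvPolynomial.X 1 + (MvPolynomial.X 0 * MvPolynomial.X 1) ^ 2) +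
    MvPolynomial.C c * (1 - MvPolynomial.X 0 * MvPolynomial.X 1)

/-- The common denominator `1 − (X₀X₁)³`. [folklore] -/
def nfDen : MvPolynomial (Fin 2) ℚ := 1 - (MvPolynomial.X 0 * MvPolynomial.X 1) ^ 3

/-- On the box the common denominator is positive. [folklore] -/
theorem aeval_nfDen_pos {x : Fin 2 → ℝ} (hx : x ∈ box) : 0 < MvPolynomial.aeval x nfDen := by
  have ht := mul_mem_Ioo hx
  have : (x 0 * x 1) ^ 3 < 1 := pow_lt_one₀ ht.1.le ht.2 (by norm_num)
  simp only [nfDen, map_sub, map_one, map_pow, map_mul, MvPolynomial.aeval_X]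
  linarith

/-- On the box the normal-form integrand IS the rational function `nfNum/nfDen` (KZ's literal
shape). [folklore] -/
theorem nfFun_eq {a b c : ℚ} {x : Fin 2 → ℝ} (hx : x ∈ box) :
    MvPolynomial.aeval x (nfNum a b c) / MvPolynomial.aeval x nfDen = nfFun a b c x := by
  have ht := mul_mem_Ioo hx
  have h1 : 1 - x 0 * x 1 ≠ 0 := by linarith [ht.2]
  have h2 : 1 + x 0 * x 1 + x 0 ^ 2 * x 1 ^ 2 ≠ 0 := by nlinarith [ht.1]
  have h3 : 1 - x 0 ^ 3 * x 1 ^ 3 ≠ 0 := by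
    have : (x 0 * x 1) ^ 3 < 1 := pow_lt_one₀ ht.1.le ht.2 (by norm_num)
    rw [mul_pow] at this
    linarith
  simp only [nfNum, nfDen, nfFun, map_add, map_sub, map_mul, map_one, map_pow, MvPolynomial.aeval_C,
    MvPolynomial.aeval_X, eq_ratCast, mul_pow]
  field_simp
  ring

/-- **The normal-form representation `[box, a + b/(1−xy) + c/(1+xy+x²y²)]`** (integrable by the
tree's `BoxIntegral.integrableOn_box_normalForm`). [folklore] -/
def nfRep (a b c : ℚ) : KZ.IntegralRep 2 where
  domain := box
  integrand := nfFun a b c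
  isSemialgebraic_domain := KZ.isSemialgebraic_box 2
  isSemialgebraicFunOn_integrand :=
    (isSemialgebraicFunOn_aeval_div_aeval (KZ.isSemialgebraic_box 2) (nfNum a b c) nfDen
      (fun _ hx => (aeval_nfDen_pos hx).ne')).congr fun _ hx => nfFun_eq hx
  integrableOn := BoxIntegral.integrableOn_box_normalForm a b c

/-- The domain of `nfRep` is the box. [folklore] -/
@[simp] theorem nfRep_domain (a b c : ℚ) : (nfRep a b c).domain = box := rfl

/-- The integrand of `nfRep`. [folklore] -/
@[simp] theorem nfRep_integrand (a b c : ℚ) : (nfRep a b c).integrand = nfFun a b c := rfl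

/-- **Value of the normal form**: `a + b·π²/6 + c·L(2,χ₋₃)` (tree:
`BoxIntegral.setIntegral_box_normalForm`). [folklore] -/
theorem value_nfRep (a b c : ℚ) :
    (nfRep a b c).value = a + b * (Real.pi ^ 2 / 6) + c * L2chi3 :=
  BoxIntegral.setIntegral_box_normalForm a b c

/-! ## §6 Rigidity of the normal forms implies CDT -/

/-- The conclusion of the support item `RigidityTwoSix` with its CDT antecedent DELETED (everything
else verbatim): equal values of two normal forms on the box force equal coefficients
(a statement variant of this file, not a literature fact). -/
def RigidityTwoSixConclusion : Prop :=
  ∀ (a b c a' b' c' : ℚ) (r r' : KZ.IntegralRep 2), r.domain = {x | ∀ i, x i ∈ Set.Ioo (0:ℝ) 1} →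
    Set.EqOn r.integrand (fun x => (a : ℝ) + b / (1 - x 0 * x 1) + c / (1 + x 0 * x 1 + (x 0 * x 1) ^ 2))
      r.domain →
    r'.domain = {x | ∀ i, x i ∈ Set.Ioo (0:ℝ) 1} →
    Set.EqOn r'.integrand (fun x => (a' : ℝ) + b' / (1 - x 0 * x 1) + c' / (1 + x 0 * x 1 + (x 0 * x 1) ^ 2))
      r'.domain →
    r.value = r'.value → a = a' ∧ b = b' ∧ c = c'

/-- **Rigidity ⇒ CDT.** If equal-valued level-6 normal forms always have equal coefficients, then
`1, π², L(2,χ₋₃) = Σ (1/(3n+1)² − 1/(3n+2)²)` are `ℚ`-linearly independent: a relation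
`g₀ + g₁π² + g₂L = 0` makes `[box, g₀ + 6g₁/(1−xy) + g₂/(1+xy+x²y²)]` and `[box, 0]` equal-valued.
So the CDT hypothesis of the route is exactly as strong as its rigidity step (converse: the tree's
`BoxIntegral.normalForm_coeff_eq`). [folklore] -/
theorem cdt_of_rigidityTwoSixConclusion (h : RigidityTwoSixConclusion) :
    LinearIndependent ℚ
      ![(1 : ℝ), Real.pi ^ 2, (∑' n : ℕ, (1 / (3 * (n : ℝ) + 1) ^ 2 - 1 / (3 * (n : ℝ) + 2) ^ 2))] := by
  rw [show (∑' n : ℕ, (1 / (3 * (n : ℝ) + 1) ^ 2 - 1 / (3 * (n : ℝ) + 2) ^ 2)) = L2chi3 from rfl]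
  refine Fintype.linearIndependent_iff.mpr fun g hg => ?_
  rw [Fin.sum_univ_three] at hg
  simp only [Matrix.cons_val_zero, Matrix.cons_val_one, Matrix.cons_val, Rat.smul_def,
    mul_one] at hg
  have key := h (g 0) (6 * g 1) (g 2) 0 0 0 (nfRep (g 0) (6 * g 1) (g 2)) (nfRep 0 0 0) rfl
    (fun _ _ => rfl) rfl (fun _ _ => rfl) (by
      rw [value_nfRep, value_nfRep]
      push_cast
      linear_combination hg)
  obtain ⟨h0, h1, h2⟩ := key
  have hg0 : g 0 = 0 := h0
  have hg1 : g 1 = 0 := by linarith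
  have hg2 : g 2 = 0 := h2
  intro i
  fin_cases i <;> assumption

/-- The same, read on the named fact. [folklore] -/
theorem calegariDimitrovTang_of_rigidityTwoSixConclusion (h : RigidityTwoSixConclusion) :
    calegariDimitrovTang_linearIndependent :=
  cdt_of_rigidityTwoSixConclusion h

/-- Hence an UNCONDITIONAL rigidity of the level-6 normal forms is out of reach of the tree exactly
as long as CDT's Theorem 1 is a named (unproved) fact: `RigidityTwoSixConclusion` cannot be proved
without proving `calegariDimitrovTang_linearIndependent`. In particular the crux's hypothesis cannot
be weakened along this route to the irrationality of `L(2,χ₋₃)` alone. [folklore] -/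
theorem irrational_L2chi3_of_rigidityTwoSixConclusion (h : RigidityTwoSixConclusion) :
    Irrational L2chi3 :=
  (calegariDimitrovTang_of_rigidityTwoSixConclusion h).irrational_L2chi3

end Summit.KontsevichZagierPeriods.Theorems.SectorTwoSix.Negative
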